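import Literature.NumberTheory.LFunctions.RayClassFiberUnsmoothing
import Summits.QuantumAdvantage.QuantumAdvantage.Theorems.LinnikCubicClassGroupsDegreeOnePrimesEscapeConjClassPNTRelativePiLemmas
import Summits.QuantumAdvantage.QuantumAdvantage.Theorems.LinnikCubicClassGroupsDegreeOnePrimesEscapePerCharacterDeficitCounting
import HarnessLib

/-!
# Linnik's theorem for cosets of a congruence class group, VIII: counting the primes of a coset (partial summation,
# Chebyshev bound, primes of degree `≥ 2`)

Topic `Summits/QuantumAdvantage/QuantumAdvantage/Theorems`, cell B2b-1 (linnik-cubic), PART A (gen 23); helper toward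
the crux `DegreeOnePrimesEscape` (stmt-QuantumAdvantage-11543) of route `LinnikCubicClassGroups`.  HONEST FRAMING: the
value of this file is a THEOREM (kernel-checked bookkeeping) — NOT summit progress.

For an abelian Frobenius datum `f : 𝔭 ↦ f 𝔭 ∈ G`, a modulus `𝔪` and `τ ∈ G` write
`π_τ(x) = #{v prime of K : 𝔪 ∤ v, f v = τ, N v ≤ x}` and `θ_τ = fiberTheta 𝔪 f τ`.
* `fiberTheta_eq_sum_filter_coset` — `θ_τ(x) = Σ_{N𝔭 ≤ x, (𝔭,𝔪)=1, F(𝔭)=τ} log N𝔭` (`F = artinSymbol f`) as a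
  predicate-restricted sum over the tree's `primeIdealsLE`; hence the Chebyshev bound `θ_τ(t) ≤ [K:ℚ](log 4+4) t`
  (`fiberTheta_le_mul`), `θ_τ(x) ≤ π_τ(x) log x` (`fiberTheta_le_card_mul_log`), integrability, and **partial summation**
  `π_τ(x) = θ_τ(x)/log x + ∫₂ˣ θ_τ(t) dt/(t log² t)` (`fiberPrimeCount_eq_theta_div_log_add_integral`, from the tree's
  `card_filter_primeIdealsLE_eq_div_log_add_integral`);
* `mem_filter_coset_iff`, `ncard_coset_eq_card_filter`, `ncard_cosetDegOne_eq_card_filter` — the dictionary between the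
  primes `v : HeightOneSpectrum (𝓞 K)` with `𝔪 ∤ v`, `f v = τ` and the ideals `𝔭` with `(𝔭,𝔪) = 1`, `F(𝔭) = τ`;
* `card_filter_primeIdealsLE_not_prime_le` — **the primes of residue degree `≥ 2` are few**: at most `[K:ℚ](√x + 1)`
  nonzero primes of norm `≤ x` have non-prime norm; hence `π_τ(x) − #{degree-one v counted by π_τ(x)} ≤ [K:ℚ](√x + 1)`
  (`ncard_coset_sub_degOne_le`).
References: J. Thorner, A. Zaman, ANT 13 (2019), §2.1 [ThornerZaman2019]; ANT 11 (2017), §3 [ThornerZaman2017].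
-/

noncomputable section

open Real MeasureTheory Set NumberField IsDedekindDomain
open scoped NumberField nonZeroDivisors

namespace Summit.QuantumAdvantage.QuantumAdvantage.Theorems.DegreeOnePrimesEscape

open Literature.NumberTheory.LFunctions Literature.NumberTheory.LFunctions.NumberField
  Literature.NumberTheory.LFunctions.AbelianDensity
open scoped Classical

section Counting

variable {K : Type} [Field K] [NumberField K]
variable {G : Type} [CommGroup G] {𝔪 : Ideal (𝓞 K)} {f : HeightOneSpectrum (𝓞 K) → G}

/-- **`θ_τ(x) = Σ_{N𝔭 ≤ x, (𝔭,𝔪)=1, F(𝔭)=τ} log N𝔭`** as a predicate-restricted sum over the nonzero primes of norm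
`≤ x` (the coset indicator is `1` exactly on the coprime-to-`𝔪` ideals with Artin symbol `τ`). -/
theorem fiberTheta_eq_sum_filter_coset (τ : G) (x : ℝ) :
    fiberTheta 𝔪 f τ x = ∑ q ∈ (finite_primeIdealsLE K x).toFinset with (IsCoprime q 𝔪 ∧ artinSymbol f q = τ),
      Real.log (Ideal.absNorm q : ℝ) := by
  unfold fiberTheta
  rw [Finset.sum_filter]
  refine Finset.sum_congr rfl fun P hP ↦ ?_
  rw [mem_primeIdealsLE_toFinset] at hP
  unfold fiberIndicatorIdeal
  by_cases h : IsCoprime P 𝔪 ∧ artinSymbol f P = τ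
  · rw [if_pos ⟨hP.2.1, h⟩, if_pos h, one_mul]
  · rw [if_neg (fun h' ↦ h h'.2), if_neg h, zero_mul]

/-- **Chebyshev for a coset**: `θ_τ(t) ≤ [K:ℚ](log 4 + 4)·t` for `t ≥ 0`. -/
theorem fiberTheta_le_mul (τ : G) {t : ℝ} (ht : 0 ≤ t) :
    fiberTheta 𝔪 f τ t ≤ Module.finrank ℚ K * (Real.log 4 + 4) * t := by
  rw [fiberTheta_eq_sum_filter_coset]
  exact (sum_filter_primeIdealsLE_log_le (fun q : Ideal (𝓞 K) ↦ IsCoprime q 𝔪 ∧ artinSymbol f q = τ) ht).2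

/-- `θ_τ(t)/(t log² t)` is interval integrable on `[2, x]`. -/
theorem intervalIntegrable_fiberTheta_div (τ : G) {x : ℝ} (hx : 2 ≤ x) :
    IntervalIntegrable (fun t : ℝ ↦ fiberTheta 𝔪 f τ t / (t * Real.log t ^ 2)) volume 2 x := by
  have heq : (fun t : ℝ ↦ fiberTheta 𝔪 f τ t / (t * Real.log t ^ 2)) = fun t : ℝ ↦
      (∑ q ∈ (finite_primeIdealsLE K t).toFinset with (IsCoprime q 𝔪 ∧ artinSymbol f q = τ),
        Real.log (Ideal.absNorm q : ℝ)) / (t * Real.log t ^ 2) := by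
    funext t; rw [fiberTheta_eq_sum_filter_coset]
  rw [heq]
  exact intervalIntegrable_sum_filter_primeIdealsLE_log_div
    (fun q : Ideal (𝓞 K) ↦ IsCoprime q 𝔪 ∧ artinSymbol f q = τ) hx

/-- A prime `𝔭 ∤ 𝔪` with `f 𝔭 = τ` and `N𝔭 ≤ x` is counted by `π_τ(x)`; conversely every counted ideal is such a
prime: the counted finset is the image of `{v : ¬ 𝔪 ≤ v, f v = τ, N v ≤ x}` under `v ↦ v.asIdeal`. -/
theorem mem_filter_coset_iff (τ : G) (x : ℝ) (q : Ideal (𝓞 K)) :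
    q ∈ (finite_primeIdealsLE K x).toFinset.filter
        (fun q : Ideal (𝓞 K) ↦ IsCoprime q 𝔪 ∧ artinSymbol f q = τ) ↔
      ∃ v : HeightOneSpectrum (𝓞 K), v.asIdeal = q ∧ ¬ 𝔪 ≤ v.asIdeal ∧ f v = τ ∧
        (Ideal.absNorm v.asIdeal : ℝ) ≤ x := by
  rw [Finset.mem_filter, mem_primeIdealsLE_toFinset]
  constructor
  · rintro ⟨⟨hprime, hq0, hle⟩, hcop, hF⟩
    refine ⟨⟨q, hprime, hq0⟩, rfl, fun hm ↦ ?_, ?_, hle⟩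
    · rw [Ideal.isCoprime_iff_sup_eq, sup_eq_left.2 hm] at hcop
      exact hprime.ne_top hcop
    · rw [← artinSymbol_asIdeal f ⟨q, hprime, hq0⟩]; exact hF
  · rintro ⟨v, rfl, hm, hF, hle⟩
    refine ⟨⟨v.isPrime, v.ne_bot, hle⟩, ?_, by rw [artinSymbol_asIdeal]; exact hF⟩
    exact Ideal.isCoprime_iff_sup_eq.2 (v.isMaximal.out.2 _ (left_lt_sup.2 hm))

/-- `π_τ(x)` counted on the primes `v` of `K`: `#{v : 𝔪 ∤ v, f v = τ, N v ≤ x}` equals the predicate-restricted count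
of ideals (the map `v ↦ v.asIdeal` is injective). -/
theorem ncard_coset_eq_card_filter (τ : G) (x : ℝ) :
    {v : HeightOneSpectrum (𝓞 K) | ¬ 𝔪 ≤ v.asIdeal ∧ f v = τ ∧ (Ideal.absNorm v.asIdeal : ℝ) ≤ x}.ncard =
      ((finite_primeIdealsLE K x).toFinset.filter
        (fun q : Ideal (𝓞 K) ↦ IsCoprime q 𝔪 ∧ artinSymbol f q = τ)).card := by
  have hinj : Function.Injective (fun v : HeightOneSpectrum (𝓞 K) ↦ v.asIdeal) :=
    fun v w h ↦ HeightOneSpectrum.ext h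
  have himg : (fun v : HeightOneSpectrum (𝓞 K) ↦ v.asIdeal) ''
      {v : HeightOneSpectrum (𝓞 K) | ¬ 𝔪 ≤ v.asIdeal ∧ f v = τ ∧ (Ideal.absNorm v.asIdeal : ℝ) ≤ x} =
      ↑((finite_primeIdealsLE K x).toFinset.filter
        (fun q : Ideal (𝓞 K) ↦ IsCoprime q 𝔪 ∧ artinSymbol f q = τ)) := by
    ext q
    rw [Set.mem_image, Finset.mem_coe, mem_filter_coset_iff]
    constructor
    · rintro ⟨v, ⟨hm, hF, hle⟩, hq⟩; exact ⟨v, hq, hm, hF, hle⟩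
    · rintro ⟨v, hq, hm, hF, hle⟩; exact ⟨v, ⟨hm, hF, hle⟩, hq⟩
  rw [← Set.ncard_image_of_injective _ hinj, himg, Set.ncard_coe_finset]

/-- **Partial summation for a coset**: `π_τ(x) = #{v : 𝔪 ∤ v, f v = τ, N v ≤ x} = θ_τ(x)/log x + ∫₂ˣ θ_τ(t) dt/(t log² t)`
for `x ≥ 2`. [cite: ThornerZaman2019, §2.1 Lemma 2.1] -/
theorem fiberPrimeCount_eq_theta_div_log_add_integral (τ : G) {x : ℝ} (hx : 2 ≤ x) :
    (({v : HeightOneSpectrum (𝓞 K) | ¬ 𝔪 ≤ v.asIdeal ∧ f v = τ ∧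
        (Ideal.absNorm v.asIdeal : ℝ) ≤ x}.ncard : ℕ) : ℝ) =
      fiberTheta 𝔪 f τ x / Real.log x + ∫ t in (2 : ℝ)..x, fiberTheta 𝔪 f τ t / (t * Real.log t ^ 2) := by
  rw [ncard_coset_eq_card_filter, card_filter_primeIdealsLE_eq_div_log_add_integral _ hx,
    fiberTheta_eq_sum_filter_coset]
  congr 1
  refine intervalIntegral.integral_congr fun t _ ↦ ?_
  simp only [fiberTheta_eq_sum_filter_coset]

/-- **`θ_τ(x) ≤ π_τ(x) · log x`** (every counted prime has `log N𝔭 ≤ log x`). -/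
theorem fiberTheta_le_card_mul_log (τ : G) (x : ℝ) :
    fiberTheta 𝔪 f τ x ≤
      ({v : HeightOneSpectrum (𝓞 K) | ¬ 𝔪 ≤ v.asIdeal ∧ f v = τ ∧ (Ideal.absNorm v.asIdeal : ℝ) ≤ x}.ncard : ℕ) *
        Real.log x := by
  rw [ncard_coset_eq_card_filter, fiberTheta_eq_sum_filter_coset]
  have h := Finset.sum_le_card_nsmul ((finite_primeIdealsLE K x).toFinset.filter
      (fun q : Ideal (𝓞 K) ↦ IsCoprime q 𝔪 ∧ artinSymbol f q = τ))
    (fun q : Ideal (𝓞 K) ↦ Real.log (Ideal.absNorm q : ℝ)) (Real.log x) (fun q hq ↦ ?_)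
  · rwa [nsmul_eq_mul] at h
  · rw [Finset.mem_filter, mem_primeIdealsLE_toFinset] at hq
    obtain ⟨⟨-, hq0, hle⟩, -⟩ := hq
    have hpos : (0 : ℝ) < (Ideal.absNorm q : ℝ) := by
      have : Ideal.absNorm q ≠ 0 := by rwa [Ne, Ideal.absNorm_eq_zero_iff]
      exact_mod_cast Nat.pos_of_ne_zero this
    exact Real.log_le_log hpos hle

/-! ### Primes of residue degree `≥ 2` are few -/

/-- **At most `[K:ℚ](√x + 1)` nonzero primes of norm `≤ x` have non-prime norm** (`x ≥ 0`): such a prime lies over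
`p ≤ √x` and at most `[K:ℚ]` primes lie over each `p` (tree: `primeIdealCount_le_degOne_add`, `ncard_degOne_eq_sum`).
[folklore] -/
theorem card_filter_primeIdealsLE_not_prime_le {x : ℝ} (hx : 0 ≤ x) :
    ((((finite_primeIdealsLE K x).toFinset.filter
        (fun q : Ideal (𝓞 K) ↦ ¬ (Ideal.absNorm q).Prime)).card : ℕ) : ℝ) ≤
      (Module.finrank ℚ K : ℝ) * (Real.sqrt x + 1) := by
  set N : ℕ := ⌊x⌋₊ with hN
  -- the counted finset only sees `⌊x⌋`
  have hS : (finite_primeIdealsLE K x).toFinset = (finite_primeIdealsLE K (N : ℝ)).toFinset := by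
    ext q; rw [mem_primeIdealsLE_toFinset, mem_primeIdealsLE_toFinset, Nat.cast_le, Nat.le_floor_iff hx]
  -- the degree-one part is the tree's degree-one set
  have hdeg : ((finite_primeIdealsLE K (N : ℝ)).toFinset.filter (fun q : Ideal (𝓞 K) ↦ (Ideal.absNorm q).Prime)).card =
      Set.ncard {P : Ideal (𝓞 K) | P.IsPrime ∧ P ≠ ⊥ ∧ (Ideal.absNorm P).Prime ∧ Ideal.absNorm P ≤ N} := by
    rw [← Set.ncard_coe_finset]
    congr 1
    ext q
    rw [Finset.coe_filter, Set.mem_setOf_eq, Set.mem_setOf_eq, mem_primeIdealsLE_toFinset, Nat.cast_le]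
    tauto
  have htot : ((finite_primeIdealsLE K (N : ℝ)).toFinset).card = primeIdealCount K (N : ℝ) := by
    rw [primeIdealCount, Set.ncard_eq_toFinset_card _ (finite_primeIdealsLE K (N : ℝ))]
  have hsplit := Finset.card_filter_add_card_filter_not
    (s := (finite_primeIdealsLE K (N : ℝ)).toFinset) (fun q : Ideal (𝓞 K) ↦ (Ideal.absNorm q).Prime)
  have h2 := primeIdealCount_le_degOne_add K N
  have h3 := ncard_degOne_eq_sum K N
  -- `π(√N) ≤ √N + 1 ≤ √x + 1`
  have hpisqrt : (Nat.primeCounting (Nat.sqrt N) : ℝ) ≤ Real.sqrt x + 1 := by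
    have ha : Nat.primeCounting (Nat.sqrt N) ≤ Nat.sqrt N + 1 := by
      rw [Nat.primeCounting, Nat.primeCounting']
      exact Nat.count_le _
    have hb : ((Nat.sqrt N : ℕ) : ℝ) ≤ Real.sqrt (N : ℝ) := by
      rw [Real.le_sqrt (by positivity) (by positivity)]
      exact_mod_cast Nat.sqrt_le' N
    have hc : Real.sqrt (N : ℝ) ≤ Real.sqrt x := Real.sqrt_le_sqrt (Nat.floor_le hx)
    calc (Nat.primeCounting (Nat.sqrt N) : ℝ) ≤ (Nat.sqrt N : ℝ) + 1 := by exact_mod_cast ha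
      _ ≤ Real.sqrt x + 1 := by linarith
  have hn0 : (0 : ℝ) ≤ Module.finrank ℚ K := Nat.cast_nonneg _
  have hcount : ((finite_primeIdealsLE K (N : ℝ)).toFinset.filter
      (fun q : Ideal (𝓞 K) ↦ ¬ (Ideal.absNorm q).Prime)).card ≤ Module.finrank ℚ K * Nat.primeCounting (Nat.sqrt N) := by
    have hcast : primeIdealCount K (N : ℝ) = primeIdealCount K ((N : ℕ) : ℝ) := rfl
    rw [hdeg, h3] at hsplit
    omega
  rw [hS]
  calc ((((finite_primeIdealsLE K (N : ℝ)).toFinset.filter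
        (fun q : Ideal (𝓞 K) ↦ ¬ (Ideal.absNorm q).Prime)).card : ℕ) : ℝ)
      ≤ (Module.finrank ℚ K : ℝ) * (Nat.primeCounting (Nat.sqrt N) : ℝ) := by exact_mod_cast hcount
    _ ≤ (Module.finrank ℚ K : ℝ) * (Real.sqrt x + 1) := mul_le_mul_of_nonneg_left hpisqrt hn0

/-- The degree-one primes of a coset, counted on the primes `v` of `K`, versus the predicate-restricted count of
ideals. -/
theorem ncard_cosetDegOne_eq_card_filter (τ : G) (x : ℝ) :
    {v : HeightOneSpectrum (𝓞 K) | ¬ 𝔪 ≤ v.asIdeal ∧ f v = τ ∧ (Ideal.absNorm v.asIdeal).Prime ∧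
        (Ideal.absNorm v.asIdeal : ℝ) ≤ x}.ncard =
      (((finite_primeIdealsLE K x).toFinset.filter
        (fun q : Ideal (𝓞 K) ↦ IsCoprime q 𝔪 ∧ artinSymbol f q = τ)).filter
          (fun q : Ideal (𝓞 K) ↦ (Ideal.absNorm q).Prime)).card := by
  have hinj : Function.Injective (fun v : HeightOneSpectrum (𝓞 K) ↦ v.asIdeal) :=
    fun v w h ↦ HeightOneSpectrum.ext h
  have himg : (fun v : HeightOneSpectrum (𝓞 K) ↦ v.asIdeal) ''
      {v : HeightOneSpectrum (𝓞 K) | ¬ 𝔪 ≤ v.asIdeal ∧ f v = τ ∧ (Ideal.absNorm v.asIdeal).Prime ∧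
        (Ideal.absNorm v.asIdeal : ℝ) ≤ x} =
      ↑(((finite_primeIdealsLE K x).toFinset.filter
        (fun q : Ideal (𝓞 K) ↦ IsCoprime q 𝔪 ∧ artinSymbol f q = τ)).filter
          (fun q : Ideal (𝓞 K) ↦ (Ideal.absNorm q).Prime)) := by
    ext q
    rw [Set.mem_image, Finset.mem_coe, Finset.mem_filter, mem_filter_coset_iff]
    constructor
    · rintro ⟨v, ⟨hm, hF, hpr, hle⟩, hq⟩
      exact ⟨⟨v, hq, hm, hF, hle⟩, by rw [← hq]; exact hpr⟩
    · rintro ⟨⟨v, hq, hm, hF, hle⟩, hpr⟩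
      exact ⟨v, ⟨hm, hF, by rw [hq]; exact hpr, hle⟩, hq⟩
  rw [← Set.ncard_image_of_injective _ hinj, himg, Set.ncard_coe_finset]

/-- **Per coset, the primes of residue degree `≥ 2` are few**:
`π_τ(x) − #{v : 𝔪 ∤ v, f v = τ, N v prime, N v ≤ x} ≤ [K:ℚ](√x + 1)` for `x ≥ 0`. [folklore] -/
theorem ncard_coset_sub_degOne_le (τ : G) {x : ℝ} (hx : 0 ≤ x) :
    (({v : HeightOneSpectrum (𝓞 K) | ¬ 𝔪 ≤ v.asIdeal ∧ f v = τ ∧ (Ideal.absNorm v.asIdeal : ℝ) ≤ x}.ncard : ℕ) : ℝ) -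
      ({v : HeightOneSpectrum (𝓞 K) | ¬ 𝔪 ≤ v.asIdeal ∧ f v = τ ∧ (Ideal.absNorm v.asIdeal).Prime ∧
        (Ideal.absNorm v.asIdeal : ℝ) ≤ x}.ncard : ℕ) ≤
      (Module.finrank ℚ K : ℝ) * (Real.sqrt x + 1) := by
  rw [ncard_coset_eq_card_filter, ncard_cosetDegOne_eq_card_filter]
  set S := (finite_primeIdealsLE K x).toFinset.filter
    (fun q : Ideal (𝓞 K) ↦ IsCoprime q 𝔪 ∧ artinSymbol f q = τ) with hSdef
  have hsplit := Finset.card_filter_add_card_filter_not (s := S)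
    (fun q : Ideal (𝓞 K) ↦ (Ideal.absNorm q).Prime)
  have hsub : (S.filter (fun q : Ideal (𝓞 K) ↦ ¬ (Ideal.absNorm q).Prime)).card ≤
      ((finite_primeIdealsLE K x).toFinset.filter (fun q : Ideal (𝓞 K) ↦ ¬ (Ideal.absNorm q).Prime)).card :=
    Finset.card_le_card (Finset.filter_subset_filter _ (Finset.filter_subset _ _))
  have h := card_filter_primeIdealsLE_not_prime_le (K := K) hx
  have e : ((S.card : ℕ) : ℝ) - ((S.filter (fun q : Ideal (𝓞 K) ↦ (Ideal.absNorm q).Prime)).card : ℕ) =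
      ((S.filter (fun q : Ideal (𝓞 K) ↦ ¬ (Ideal.absNorm q).Prime)).card : ℕ) := by
    rw [← hsplit]; push_cast; ring
  rw [e]
  exact le_trans (by exact_mod_cast hsub) h

end Counting

end Summit.QuantumAdvantage.QuantumAdvantage.Theorems.DegreeOnePrimesEscape

end
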